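import Mathlib
import Summits.Ventures.HodgeRepro2.Tier7.Line2.GaloisDefs

/-!
# Tier 7 — LINE 2 / Galois support: `GaloisRationality R` for every rational structure (`Line2/GaloisPeriod.lean`;
assembled by t7-L1-p5 gen 1 per t7-plan-2's ruling STATUS l. 14990; the proof is t7-L1-p4's, l. 14989)

LEMMA B of t7-plan-2's Galois module (`GALOIS-LEMMAS.md` lemma 2; Tier 4's trace identity `f_forall` p387267 CITED, never
imported): for every rational structure `R` on a period datum and every choice of Hecke translates `g`, the σ-eigen-periods
`eigenPeriod R σ g = ∫_X ∏_i g_i • f_i^*(ε_{i,σ})` are the Galois conjugates `σ c` of ONE element `c ∈ K`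
(`eigenPeriod_galois'`), so `GaloisRationality R` holds (`galoisRationality`) — the displayed hypothesis `hB` of the bridge
`conclusion_perm_iff` / `rtfConclusion_perm_iff` (Galois.lean v3) is a THEOREM.

PROOF (t7-L1-p4, route/t7/L1-p4/GaloisB.scratch.lean sha256 f199ac9d7e3488a9589ba14011e1d3ae1a4cf2851265467ee77401cbc1f11026
ll. 163–346, names unchanged): (a) `ratVec_eq_sum`: `1 ⊗ x = ∑ σ, σ x • ε_σ` (`eps_sum`, `eps_eigen`); (b) the trace as a
sum over the ring embeddings (`trace_eq_sum_ringHom`), a ℚ-basis `qBasis` of `K` and its trace-dual basis `dBasis`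
(`traceForm_nondegenerate`, `dualBasis`), and the δ-identity `sum_emb_qBasis_mul_emb_dBasis : ∑ k, σ (x_k) τ (y_k) = [σ = τ]`
(the two embedding matrices are mutually inverse: `apply_dualBasis_left` + `Matrix.mul_eq_one_comm`); (c) the contraction
`sum_emb_dBasis_smul_ratVec` and the one-slot lemma `sum_T_ratVec_mul`, applied three times inside out to the NESTED rational
Weil class `weilClass D g x` (`weilClass_eq_sum : W(g; x) = ∑ τ, τ x • Π_τ(g)`); (d) `weilClass_rat : ∫_X W(g; x) ∈ ℚ`
(`R.rat` term by term); (e) WITHOUT Dedekind: `c := ∑ k, q_k • y_k` with `q_k = ∫_X W(g; x_k)`, and `σ c = ∑ τ, P_τ ∑ k,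
τ (x_k) σ (y_k) = P_σ` by the δ-identity. Independent full proofs of the same identity by t7-L1-p5 (abstract form
`exists_galois`, route/t7/Line2/p5/GaloisWeil.selfcontained.lean) and by t7-plan-2 (number-field half, `Line2/GaloisTrace.lean`
p668640) are on the record; this module is the text of record for the chain (plan-2 l. 14990). Support only (flexibility
for Line 3's device, lead l. 14933 (2)); nothing about the step.
Sorry-free; axioms: propext / Classical.choice / Quot.sound. §8(d): uses an L-value-free non-vanishing device: NO.
-/

namespace Summit.Ventures.HodgeRepro2.Tier7.Line2.Galois

open Summit.Ventures.HodgeRepro2 (IsWeilFace IsCMType)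
open Summit.Ventures.HodgeRepro2.T6 (KC H1C eigenLine eigenLineK)
open Summit.Ventures.HodgeRepro2.Tier7

noncomputable section

variable {K : Type} [Field K] [NumberField K] {E' : Type} [Field E'] [NumberField E']
  {V : Type} [AddCommGroup V] [Module E' V] {HX : Type} [Ring HX] [Algebra ℂ HX]
  {G : Type} [Group G] [MulAction G HX]

variable {D : PeriodDatum K E' V HX G}

/-! ## B. The Galois trace identity (t7-L1-p4's proof, names unchanged) -/

/-- (a) the rational class `1 ⊗ x` is the sum of its eigen-components -/
theorem ratVec_eq_sum (R : RationalStructure D) (x : K) : ratVec x = ∑ σ : K →+* ℂ, σ x • R.eps σ := by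
  calc ratVec x = ratVec x * ∑ σ : K →+* ℂ, R.eps σ := by rw [R.eps_sum, mul_one]
    _ = ∑ σ : K →+* ℂ, ratVec x * R.eps σ := Finset.mul_sum _ _ _
    _ = ∑ σ : K →+* ℂ, σ x • R.eps σ := Finset.sum_congr rfl fun σ _ => R.eps_eigen σ x


/-- the trace of `K/ℚ` is the sum of the embeddings into `ℂ` (`trace_eq_sum_embeddings`, ring-hom form) -/
theorem trace_eq_sum_ringHom (z : K) : algebraMap ℚ ℂ (Algebra.trace ℚ K z) = ∑ σ : K →+* ℂ, σ z := by
  rw [trace_eq_sum_embeddings (K := ℚ) (L := K) (E := ℂ)]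
  exact (Fintype.sum_equiv RingHom.equivRatAlgHom (fun σ : K →+* ℂ => σ z) (fun φ => φ z) (fun σ => rfl)).symm

section DualBasis

open scoped Classical

/-- a ℚ-basis of `K` -/
noncomputable def qBasis : Module.Basis (Fin (Module.finrank ℚ K)) ℚ K := Module.finBasis ℚ K

/-- the trace-dual basis: `Tr (dBasis i * qBasis j) = δ_ij` -/
noncomputable def dBasis : Module.Basis (Fin (Module.finrank ℚ K)) ℚ K :=
  (Algebra.traceForm ℚ K).dualBasis (traceForm_nondegenerate ℚ K) (qBasis (K := K))

/-- (PROVED) duality of the two bases: `trace (y_i x_j) = [i = j]` -/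
theorem trace_dBasis_mul_qBasis (i j : Fin (Module.finrank ℚ K)) :
    Algebra.trace ℚ K (dBasis (K := K) i * qBasis (K := K) j) = if j = i then 1 else 0 := by
  rw [← Algebra.traceForm_apply]
  exact LinearMap.BilinForm.apply_dualBasis_left (traceForm_nondegenerate ℚ K) (qBasis (K := K)) i j

/-- the embeddings, enumerated by `Fin (finrank ℚ K)` -/
noncomputable def embEquiv : (K →+* ℂ) ≃ Fin (Module.finrank ℚ K) :=
  Fintype.equivFinOfCardEq (NumberField.Embeddings.card K ℂ)

/-- THE δ-IDENTITY: `∑ k, σ (x_k) τ (y_k) = [σ = τ]` for a ℚ-basis `x` and its trace-dual basis `y` -/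
theorem sum_emb_qBasis_mul_emb_dBasis (σ τ : K →+* ℂ) :
    ∑ k, σ (qBasis (K := K) k) * τ (dBasis (K := K) k) = if σ = τ then 1 else 0 := by
  let e := embEquiv (K := K)
  let X : Matrix (Fin (Module.finrank ℚ K)) (Fin (Module.finrank ℚ K)) ℂ := fun a k => (e.symm a) (qBasis k)
  let Y : Matrix (Fin (Module.finrank ℚ K)) (Fin (Module.finrank ℚ K)) ℂ := fun a k => (e.symm a) (dBasis k)
  have hYX : Y.transpose * X = 1 := by
    ext k l
    simp only [Matrix.mul_apply, Matrix.transpose_apply, Matrix.one_apply, X, Y]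
    have : ∑ a, (e.symm a) (dBasis k) * (e.symm a) (qBasis l) = ∑ ρ : K →+* ℂ, ρ (dBasis k * qBasis l) := by
      rw [← Equiv.sum_comp e.symm (fun ρ : K →+* ℂ => ρ (dBasis k * qBasis l))]
      exact Finset.sum_congr rfl fun a _ => (map_mul _ _ _).symm
    rw [this, ← trace_eq_sum_ringHom, trace_dBasis_mul_qBasis]
    by_cases h : k = l
    · subst h; simp
    · simp [h, Ne.symm h]
  have hXY : X * Y.transpose = 1 := mul_eq_one_comm.mp hYX
  have := congrFun (congrFun hXY (e σ)) (e τ)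
  simp only [Matrix.mul_apply, Matrix.transpose_apply, Matrix.one_apply, X, Y, Equiv.symm_apply_apply,
    EmbeddingLike.apply_eq_iff_eq] at this
  exact this

/-- CONTRACTION: `∑ l, τ (y_l) • (1 ⊗ c x_l) = τ (c) • ε_τ` -/
theorem sum_emb_dBasis_smul_ratVec (R : RationalStructure D) (τ : K →+* ℂ) (c : K) :
    ∑ l, τ (dBasis (K := K) l) • ratVec (c * qBasis (K := K) l) = τ c • R.eps τ := by
  simp_rw [ratVec_eq_sum R (c * qBasis _), map_mul, Finset.smul_sum, smul_smul]
  rw [Finset.sum_comm]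
  simp_rw [← Finset.sum_smul]
  have h : ∀ ρ : K →+* ℂ, ∑ l, τ (dBasis (K := K) l) * (ρ c * ρ (qBasis (K := K) l)) =
      (if ρ = τ then 1 else 0) * ρ c := by
    intro ρ
    rw [← sum_emb_qBasis_mul_emb_dBasis ρ τ, Finset.sum_mul]
    exact Finset.sum_congr rfl fun l _ => by ring
  simp_rw [h]
  simp [Finset.sum_ite_eq']

/-- LEMMA L (one slot): `∑ l, T (1 ⊗ c x_l) * (∑ τ, τ (y_l) • P τ) = ∑ τ, τ c • (T ε_τ * P τ)` -/
theorem sum_T_ratVec_mul (R : RationalStructure D) (T : KC K →ₗ[ℂ] HX) (P : (K →+* ℂ) → HX) (c : K) :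
    ∑ l, T (ratVec (c * qBasis (K := K) l)) * (∑ τ, τ (dBasis (K := K) l) • P τ) =
      ∑ τ, τ c • (T (R.eps τ) * P τ) := by
  calc ∑ l, T (ratVec (c * qBasis (K := K) l)) * (∑ τ, τ (dBasis (K := K) l) • P τ)
      = ∑ l, ∑ τ, τ (dBasis (K := K) l) • (T (ratVec (c * qBasis (K := K) l)) * P τ) := by
        simp_rw [Finset.mul_sum, mul_smul_comm]
    _ = ∑ τ, ∑ l, τ (dBasis (K := K) l) • (T (ratVec (c * qBasis (K := K) l)) * P τ) := Finset.sum_comm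
    _ = ∑ τ, (∑ l, τ (dBasis (K := K) l) • T (ratVec (c * qBasis (K := K) l))) * P τ := by
        simp_rw [Finset.sum_mul, smul_mul_assoc]
    _ = ∑ τ, T (∑ l, τ (dBasis (K := K) l) • ratVec (c * qBasis (K := K) l)) * P τ := by
        simp_rw [map_sum, map_smul]
    _ = ∑ τ, τ c • (T (R.eps τ) * P τ) := by
        simp_rw [sum_emb_dBasis_smul_ratVec R, map_smul, smul_mul_assoc]

end DualBasis

section Weil

open scoped Classical

/-- a Hecke translate as a ℂ-linear map -/
def actLin (S : SurfaceShadow HX G) (h : G) : HX →ₗ[ℂ] HX where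
  toFun a := h • a
  map_add' := S.act_add h
  map_smul' c a := S.act_smul h c a

/-- the `i`-th translated pull-back `u ↦ g_i • f_i^*(u)`, ℂ-linear in `u` -/
def tl (D : PeriodDatum K E' V HX G) (g : Fin 4 → G) (i : Fin 4) : KC K →ₗ[ℂ] HX :=
  actLin D.S (g i) ∘ₗ D.alb ∘ₗ slot i

/-- (PROVED) unfolding of the translated pull-back -/
theorem tl_apply (D : PeriodDatum K E' V HX G) (g : Fin 4 → G) (i : Fin 4) (u : KC K) :
    tl D g i u = g i • D.alb (slot i u) := rfl

/-- the rational Weil class `W(g; x) = ∑_{k,l,m} (g_0 f_0^*(x x_k)) (g_1 f_1^*(y_k x_l)) (g_2 f_2^*(y_l x_m)) (g_3 f_3^*(y_m))`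
(nested) -/
def weilClass (D : PeriodDatum K E' V HX G) (g : Fin 4 → G) (x : K) : HX :=
  ∑ k, tl D g 0 (ratVec (x * qBasis (K := K) k)) *
    (∑ l, tl D g 1 (ratVec (dBasis (K := K) k * qBasis (K := K) l)) *
      (∑ m, tl D g 2 (ratVec (dBasis (K := K) l * qBasis (K := K) m)) * tl D g 3 (ratVec (dBasis (K := K) m))))

/-- the Weil class is the sum of the eigen-products: `W(g; x) = ∑_τ τ(x) Π_τ(g)` -/
theorem weilClass_eq_sum (R : RationalStructure D) (g : Fin 4 → G) (x : K) :
    weilClass D g x = ∑ τ : K →+* ℂ, τ x •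
      (tl D g 0 (R.eps τ) * tl D g 1 (R.eps τ) * tl D g 2 (R.eps τ) * tl D g 3 (R.eps τ)) := by
  have h3 : ∀ m, tl D g 3 (ratVec (dBasis (K := K) m)) = ∑ τ, τ (dBasis (K := K) m) • tl D g 3 (R.eps τ) := by
    intro m
    rw [ratVec_eq_sum R, map_sum]
    simp_rw [map_smul]
  have hin : ∀ l, (∑ m, tl D g 2 (ratVec (dBasis (K := K) l * qBasis (K := K) m)) * tl D g 3 (ratVec (dBasis (K := K) m))) =
      ∑ τ, τ (dBasis (K := K) l) • (tl D g 2 (R.eps τ) * tl D g 3 (R.eps τ)) := by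
    intro l
    simp_rw [h3]
    exact sum_T_ratVec_mul R _ _ _
  have hmid : ∀ k, (∑ l, tl D g 1 (ratVec (dBasis (K := K) k * qBasis (K := K) l)) *
      (∑ m, tl D g 2 (ratVec (dBasis (K := K) l * qBasis (K := K) m)) * tl D g 3 (ratVec (dBasis (K := K) m)))) =
      ∑ τ, τ (dBasis (K := K) k) • (tl D g 1 (R.eps τ) * (tl D g 2 (R.eps τ) * tl D g 3 (R.eps τ))) := by
    intro k
    simp_rw [hin]
    exact sum_T_ratVec_mul R _ _ _
  unfold weilClass
  simp_rw [hmid]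
  rw [sum_T_ratVec_mul R]
  simp_rw [mul_assoc]

/-- the period of the Weil class is rational (`rat` on every term) -/
theorem weilClass_rat (R : RationalStructure D) (g : Fin 4 → G) (x : K) :
    ∃ q : ℚ, D.S.intX (weilClass D g x) = (q : ℂ) := by
  have key : D.S.intX (weilClass D g x) ∈ (algebraMap ℚ ℂ).range := by
    unfold weilClass
    simp only [Finset.mul_sum]
    rw [map_sum]
    refine Subring.sum_mem _ fun k _ => ?_
    rw [map_sum]
    refine Subring.sum_mem _ fun l _ => ?_
    rw [map_sum]
    refine Subring.sum_mem _ fun m _ => ?_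
    obtain ⟨q, hq⟩ := R.rat g ![x * qBasis (K := K) k, dBasis (K := K) k * qBasis (K := K) l,
      dBasis (K := K) l * qBasis (K := K) m, dBasis (K := K) m]
    refine ⟨q, ?_⟩
    have hq' : D.S.intX (tl D g 0 (ratVec (x * qBasis (K := K) k)) *
        tl D g 1 (ratVec (dBasis (K := K) k * qBasis (K := K) l)) *
        tl D g 2 (ratVec (dBasis (K := K) l * qBasis (K := K) m)) *
        tl D g 3 (ratVec (dBasis (K := K) m))) = (q : ℂ) := hq
    rw [eq_ratCast, ← hq']
    simp only [mul_assoc]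
  obtain ⟨q, hq⟩ := key
  exact ⟨q, hq.symm⟩

/-- LEMMA B: the σ-eigen-periods are the Galois conjugates of one element `c ∈ K`:
`c := ∑_k λ(x_k) y_k` with `λ(x) = ∫_X W(g; x) ∈ ℚ` (`weilClass_rat`), and `σ c = ∑_k λ(x_k) σ(y_k) =
∑_τ P_τ ∑_k τ(x_k) σ(y_k) = P_σ` (`weilClass_eq_sum` + the δ-identity). -/
theorem eigenPeriod_galois' (R : RationalStructure D) (g : Fin 4 → G) :
    ∃ c : K, ∀ σ : K →+* ℂ, eigenPeriod R σ g = σ c := by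
  choose q hq using fun j => weilClass_rat R g (qBasis (K := K) j)
  refine ⟨∑ k, q k • dBasis (K := K) k, fun σ => ?_⟩
  have hc : σ (∑ k, q k • dBasis (K := K) k) = ∑ k, (q k : ℂ) * σ (dBasis (K := K) k) := by
    rw [map_sum]
    exact Finset.sum_congr rfl fun k _ => by rw [map_rat_smul, Rat.smul_def]
  have hqk : ∀ k, (q k : ℂ) = ∑ τ, τ (qBasis (K := K) k) * eigenPeriod R τ g := by
    intro k
    rw [← hq k, weilClass_eq_sum R, map_sum]
    exact Finset.sum_congr rfl fun τ _ => by rw [map_smul, smul_eq_mul]; rfl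
  rw [hc]
  simp_rw [hqk]
  have hswap : ∑ k, (∑ τ, τ (qBasis (K := K) k) * eigenPeriod R τ g) * σ (dBasis (K := K) k) =
      ∑ τ, eigenPeriod R τ g * ∑ k, τ (qBasis (K := K) k) * σ (dBasis (K := K) k) := by
    simp_rw [Finset.sum_mul]
    rw [Finset.sum_comm]
    refine Finset.sum_congr rfl fun τ _ => ?_
    rw [Finset.mul_sum]
    exact Finset.sum_congr rfl fun k _ => by ring
  rw [hswap]
  simp_rw [sum_emb_qBasis_mul_emb_dBasis]
  simp [Finset.sum_ite_eq']

end Weil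

/-- **(PROVED) `GaloisRationality R` holds for EVERY rational structure** — the displayed hypothesis of
`conclusion_perm_iff` / `rtfConclusion_perm_iff` is a theorem. -/
theorem galoisRationality (R : RationalStructure D) : GaloisRationality R :=
  fun g => eigenPeriod_galois' R g

end

end Summit.Ventures.HodgeRepro2.Tier7.Line2.Galois
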